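import Summits.BirchSwinnertonDyer.Rank1Residual.X2.CellCBDPValueContinuousDisplay
import Summits.BirchSwinnertonDyer.Rank1Residual.X2.OpenDiscSeriesContinuity
import Summits.BirchSwinnertonDyer.Rank1Residual.X2.NonsplitBDPValueDisplayRescale
import Literature.NumberTheory.QuadraticFields.ImaginaryResiduePiForm
import Literature.NumberTheory.EllipticCurves.HeegnerHypothesisKroneckerProofs
import HarnessLib

/-!
# X2c at `p ‖ N` (either sign; every odd `p`, aimed at `p = 3`), road LZZ IN THE KERNEL, part 1: the typed INPUT
# `LZZRoadInput` — Liu–Zhang–Zhang 2018 Thm. 3.8 ∧ Thm. 3.10 ∧ Prop. 4.12 on the modular curve in TREE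
# CURRENCY (c2v MEMO-1/2's dictionary, the Amice power series of `𝓛|_Γ`, the Shimura–Maass law, the two
# Petersson identities and the class number formula as displayed clauses) + the two field identities of the
# rescale (cell `bsd-eis`, seat `bsd-eis-cgshw` g14; route `EisensteinPrimes`, crux 4 `BSDpOnCellC` =
# stmt-BirchSwinnertonDyer-19034, line b1 v9; RULING L43 (2) «COMMISSION (O2)-LZZ@3»: the «kernel rescale + consumer»
# half, written AHEAD of the typist's Literature filing so that the filing's acceptance test is ONE implication
# `FACT-LZZ ⟹ LZZRoadInput`; part 2 = `X2/CellCBDPValueLZZRoad.lean` proves `LZZRoadInput ⟹ X2.BDPValueContinuousDisplayAt`)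

HONEST FRAMING (cell `bsd-eis`, run/shared/lean/pub/bsd-eis/): ONE hypothesis-shaped `@[conjecture]` predicate (a
typed INPUT — nothing asserted; it is NOT a Literature fact and is not claimed to be printed verbatim anywhere: it
is the TREE-CURRENCY rendering of LZZ18 Thm. 3.8 ∧ 3.10 ∧ Prop. 4.12 through the readings R-D / R-D′ / (AV-p) /
R-L1→(L3′) / R-N1→(L4) / R-N3 / R-P / R-M and the printed identities (L5) Collins 2020 Thm. 5 = Hida 1981 Thm.
5.1, Tamagawa–Petersson conversion (YZZ13 §1.6), (L6) the analytic class number formula — each clause carries its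
locator below; the typist of COMMISSION (O2)-LZZ@3 files the Literature side and proves `LZZRoadInput` from it,
the cell referee scores each clause PASS / SMUGGLED) + two field identities (theorems). Nothing booked; X2 stays
CONSTRUCTION-SHAPED; no label or count moves; BSD is not proved by any of this. Companion memo:
`HOME/cgshw-MEMO-18.md` §4–§5; the factor ledger is c2v MEMO-2 (referee-sheet PASS), its arithmetic is also the
kernel identity `X2.lzzLedger_constant_eq` (`X2/LZZRoadLedgerConstant.lean`).

## The input, clause by clause (symbols of `LZZRoadInput`; F = ℚ, g = 1, 𝔹 ramified at ∞ only, A = E, M = ℚ)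

Data: `ι : ℚ̄_p ≃ ℂ`; `W/ℚ` globally minimal of conductor `N`, `p ∣ N`, `p² ∤ N` (π_p = St ⊗ μ₀, a_p = ±1); `K`
imaginary quadratic, `p` split, `𝔭 ∋ p` singled out by `ι`; Heegner hypothesis for `N` (so 𝔹_χ = M₂ for every
character used: R-D′); `κ` anticyclotomic with generator `γ`; `f` a newform of `W`; `Dt` a parametrisation with Manin
constant `Dt.c`; `P ∈ E(K)` with `ι_K(P) = P_K` the trace Heegner point; `e : K → ℚ_p` inducing `𝔭`. ∃-bound:
`a : ℕ → ℂ_p` (Amice coefficients of `𝓛(E)|_Γ` along `γ`, (L3′): LZZ §2.1 via [ST01] Thms. 2.3/3.6 — `𝒟` on a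
`ℤ_p`-line = rigid functions on the OPEN unit disc; clause: `‖a_m‖ρ^m` bounded for every `0 < ρ < 1` — the CORRECTED
predicate is `LZZRoadInputIoo`, §3, RULING L53; `LZZRoadInput` itself keeps the over-strong `ρ < 1`); `C₁` = `C_ι(1)`
of Prop. 4.12 (real, sign `sC`); `ζζ ∈ ℂ^×` = `ζ⁺ζ⁻` (Lemma 4.11); `ξ` = a χ-INDEPENDENT constant
with `‖ι⁻¹ξ‖_p = 1` (room for sign / root-of-unity conventions of ψ, 𝔠, w_f — Rem. 1.7; any genuine non-unit would
have to be shown a unit by the typist, which is exactly c2v's ledger); `L1η` = `L^{fin}(1,η_K)`; `A₀` = `(φ_E,φ_E)_A` (Def.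
3.4); `Pet` = `⟨f,f⟩_{Γ₀(N)}` (un-normalised); `LAd` = `L^{fin}(1, Ad f)`; `B` = `∏_{q∣N}β_q` (new-vector toric
constants, Lemma 4.6: `1+q⁻¹` at `q ‖ N` — R-N3; `β_ℓ = 1` at `ℓ ∣ d_K`); `aSM ∈ ℤ, sG`: the Shimura–Maass step constant
`g = sG·2^{aSM}` of (L4) (R-N1: Bump 1997 (1.4)/Prop. 2.1.3, `C_ι(k) = Γ(k)Γ(k+1)g^{k−1}C_ι(1)`); `s₂` = the sign of
`P_K^−` against `P_K` (R-P); `ϖ ∈ {p, p⁻¹}`, `σ𝔭` : (AV-p) the avatar at the prime above `p`: `ι⁻¹(φ(ϖ_𝔭)) =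
ϖ^n·r(σ𝔭)` (Def. 1.5 at the idèle `(1, p)`: `χ^{(ι)}_𝔭(t) = ι((t_𝔓/t_𝔓^c)^{−w}χ_𝔭(t))`; either orientation allowed);
`σt, τ`: `χ^{(ι)}(t₊⁻¹t₋) = ι(r(σt)·τ^{−n})` for the CM-point idèle of Prop. 4.12 (same Def. 1.5).
(L1) = Thm. 3.8's display [arXiv:1511.08172 p. 18 L62–76] with the TRUE measure constant `2^{g−3}π^gδ_E^{−½}ζ_F(2)`
(reading R-M of c2v MEMO-2 §4: the printed `δ^{+½}` is off by `π/δ` against YZZ13 §1.6; it moves no valuation —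
`X2.lzzLedger_printedConstant_eq`) × Prop. 4.12's `𝐏_ι(χ) = C_ι(k)(ζ⁺ζ⁻)^kχ^{(ι)}(t₊⁻¹t₋)` [p. 23 L90] × (L4), at
every unramified `φ` of type `(n, −n)`, `n ≥ 1`, with avatar through `κ` (A-related by R-D′), the Steinberg local
factor EXPLICIT: `ε/L² = (−a_p φ(ϖ_𝔭))·(1 − a_p p⁻¹ φ(ϖ_𝔭))²` [Gelbart 1975 Thm. 6.15; c2v MEMO-1 (N2)], the value
delivered as `HasSum (a_m (r(γ) − 1)^m) (ι⁻¹(…))`. (L2) = Thm. 3.10 at `χ = 𝟙`, `f_± = φ_E`, `ω_± = ω_E`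
[p. 18 L133–140; (3.3) p. 18 L104–110]: `s₂·(h_K⁻¹·log_{ω_E}P)² = 𝓛(𝟙)·(L²/ε)(𝟙)·α_𝟙`, `𝓛(𝟙) = a_0`,
`(L²/ε)(𝟙) = ((−a_p)(1 − a_p p⁻¹)²)⁻¹`, `α_𝟙 = ι⁻¹(A₀·B)`. (L5): `LAd = 8π³·Pet·B/ψ(N)` [Collins AMQ 2020 Thm. 5
p. 10; Hida 1981 Thm. 5.1], `C₁·A₀ = sC·24π·c_M²·Pet/ψ(N)` [YZZ13 §1.6; Collins p. 9–10], `ψ(N) = N∏_{q∣N}(1+q⁻¹)`.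
(L6): `L1η = 2πh_K/(w_K√δ_K)` (in the tree: `Quadratic.LFunction_one_eq_of_discr_neg_of_eq`).

What this is NOT: not a Literature filing and not a claim that `LZZRoadInput` is printed; not a proof of any main
conjecture; no census move until the typist's fact lands and the referee passes the clauses. Nothing booked.

References: [LiuZhangZhang2018] Def. 1.5, §2.1, Def. 3.4, Def. 3.7, Thm. 3.8, (3.3), Thm. 3.10, Def. 4.4, Lemma 4.6,
Lemma 4.11, Prop. 4.12 (arXiv:1511.08172 pp. 4, 7, 16–23); [SchneiderTeitelbaum2001] Thms. 2.3/3.6;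
[YuanZhangZhang2013] §1.6, Thm. 1.4; [Collins2020] Thm. 5; [Hida1981] Thm. 5.1; [Gelbart1975] Thm. 6.15;
[Bump1997] (1.4), Prop. 2.1.3; [Washington1997] §7.1; c2v MEMO-1/2; cgshw MEMO-18.
-/

set_option autoImplicit false

noncomputable section

open scoped Classical MatrixGroups ModularForm Topology

open Filter CongruenceSubgroup WeierstrassCurve NumberField IsDedekindDomain Field PowerSeries
  Literature.NumberTheory.EllipticCurves Literature.NumberTheory.EllipticCurves.GreenbergSelmer
  Literature.NumberTheory.EllipticCurves.ModularForms
  Literature.NumberTheory.EllipticCurves.Rank1Residual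
  Literature.NumberTheory.EllipticCurves.Rank1Residual.Typed
  Literature.NumberTheory.GaloisRepresentations Literature.NumberTheory.GaloisCohomology
  Literature.NumberTheory.Automorphic
  Summit.BirchSwinnertonDyer.Rank1Residual.X11b.AcSelmer
  Summit.BirchSwinnertonDyer.Rank1Residual.X11b.Halves
  Summit.BirchSwinnertonDyer.Rank1Residual.X11b

namespace Summit.BirchSwinnertonDyer.Rank1Residual.X2
/-! ### §1 The typed input -/

section Input

/-- **`LZZRoadInput` — Liu–Zhang–Zhang 2018 Thm. 3.8 ∧ Thm. 3.10 ∧ Prop. 4.12 on the modular curve at `p ∣ N`,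
`p² ∤ N`, IN TREE CURRENCY** (clauses (L1)–(L6), (L3′), (AV-p) of the module docstring; every LZZ constant that
cancels in the rescale is ∃-bound opaquely, every constant carrying `p`-adic valuation is explicit). A typed INPUT:
hypothesis-shaped, nothing asserted, to be implied by the typist's Literature filing of COMMISSION (O2)-LZZ@3 (each
clause ↔ its printed locator; readings R-D/R-D′/(AV-p)/(L3′)/R-N1/R-N3/R-P/R-M flagged there and in c2v MEMO-1/2).
[cite: LiuZhangZhang2018, Thm. 3.8 and Thm. 3.10 and Prop. 4.12 (arXiv:1511.08172 pp. 18, 23) (shape; nothing asserted)]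
[cite: LiuZhangZhang2018, §2.1 and Def. 1.5 (arXiv:1511.08172 pp. 4, 7) (Amice power series on the Γ-line; the avatar at 𝔭)]
[cite: Washington1997, §7.1 (power series on the open unit disc)] -/
@[conjecture]
def LZZRoadInput : Prop :=
  ∀ {p : ℕ} [Fact p.Prime] (ι : PadicAlgCl p ≃+* ℂ) (W : WeierstrassCurve ℚ) [W.IsElliptic]
    [W.IsGloballyMinimal] (K : Type) [Field K] [NumberField K] (𝔭 : HeightOneSpectrum (𝓞 K))
    (κ : ZpExtension K p) (γ : absoluteGaloisGroup K) {N : ℕ} [NeZero N]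
    (Dt : ModularParametrizationData W N) (H : HeegnerDatum N (NumberField.discr K))
    (ιK : K →+* ℂ) (e : K →+* ℚ_[p]) (P : (W.baseChange K).toAffine.Point)
    (f : CuspForm (CongruenceSubgroup.Gamma0 N) 2),
    W.conductorNorm ℤ = N → p ∣ N → ¬ p ^ 2 ∣ N →
    IsImaginaryQuadratic K → ((Ideal.span {(p : ℤ)}).primesOver (𝓞 K)).ncard = 2 →
    ((p : ℕ) : 𝓞 K) ∈ 𝔭.asIdeal →
    (∀ (w' : InfinitePlace K) (k : 𝓞 K), k ∈ 𝔭.asIdeal ↔ ‖ι.symm (w'.embedding (k : K))‖ < 1) →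
    SatisfiesHeegnerHypothesis N K → κ.IsAnticyclotomic → κ.IsTopGenerator γ →
    IsNewformOf W f →
    WeierstrassCurve.Affine.Point.map ιK.toRatAlgHom P = heegnerPointComplex Dt H →
    (∀ k : 𝓞 K, k ∈ 𝔭.asIdeal ↔ ‖e (k : K)‖ < 1) →
    ∃ (a : ℕ → ℂ_[p]) (ζζ ξ : ℂ) (C₁ L1η A₀ Pet LAd B : ℝ) (aSM : ℤ) (sG sC s₂ : ℤ) (ϖ τ : ℚ_[p])
      (σt σ𝔭 : absoluteGaloisGroup K),
      (∀ ρ : ℝ, ρ < 1 → ∃ C : ℝ, ∀ m, ‖a m‖ * ρ ^ m ≤ C) ∧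
      C₁ ≠ 0 ∧ ζζ ≠ 0 ∧ ‖((ι.symm ξ : PadicAlgCl p) : ℂ_[p])‖ = 1 ∧
      0 < L1η ∧ 0 < A₀ ∧ 0 < Pet ∧ LAd ≠ 0 ∧ 0 < B ∧ τ ≠ 0 ∧
      (ϖ = p ∨ ϖ = (p : ℚ_[p])⁻¹) ∧ (sG = 1 ∨ sG = -1) ∧ (sC = 1 ∨ sC = -1) ∧ (s₂ = 1 ∨ s₂ = -1) ∧
      L1η = 2 * Real.pi * (NumberField.classNumber K : ℝ) /
        ((NumberField.Units.torsionOrder K : ℕ) * Real.sqrt |(NumberField.discr K : ℝ)|) ∧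
      LAd = 8 * Real.pi ^ 3 * Pet * B / ((N : ℝ) * ∏ q ∈ N.primeFactors, (1 + ((q : ℝ))⁻¹)) ∧
      C₁ * A₀ = sC * (24 * Real.pi * ((Dt.c : ℝ)) ^ 2 * Pet /
        ((N : ℝ) * ∏ q ∈ N.primeFactors, (1 + ((q : ℝ))⁻¹))) ∧
      (∀ (φ : HeckeCharacter K) (n : ℕ) (r : FramedGaloisRep K (PadicAlgCl p) 1), 0 < n →
        (∀ v : HeightOneSpectrum (𝓞 K), φ.IsUnramifiedAt v) →
        φ.HasInfinityType (fun _ ↦ (n : ℤ)) (fun _ ↦ -(n : ℤ)) →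
        IsPAdicAvatarOf ι φ r → FactorsThroughZp κ r →
        ι.symm (heckeValueExtZero φ 𝔭) = (algebraMap ℚ_[p] (PadicAlgCl p) ϖ) ^ n *
            ((Matrix.GeneralLinearGroup.det (r σ𝔭) : (PadicAlgCl p)ˣ) : PadicAlgCl p) ∧
        HasSum (fun m ↦ a m * (avatarValueAt r γ - 1) ^ m)
          ((ι.symm (ξ *
            rankinSelbergValueHecke f φ 1 *
            ((Real.pi : ℂ) * ((Real.pi : ℂ) ^ 2 / 6) /
              (4 * (Real.sqrt |(NumberField.discr K : ℝ)| : ℂ) * (L1η : ℂ) ^ 2 * (LAd : ℂ))) *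
            ((C₁ : ℂ) * (Complex.Gamma (n : ℂ) * Complex.Gamma ((n : ℂ) + 1)) *
              ((sG : ℂ) * (2 : ℂ) ^ aSM) ^ (n - 1) * ζζ ^ n *
              ι (((Matrix.GeneralLinearGroup.det (r σt) : (PadicAlgCl p)ˣ) : PadicAlgCl p) *
                ((algebraMap ℚ_[p] (PadicAlgCl p) τ) ^ n)⁻¹)) *
            (-(cuspCoeff f p) * heckeValueExtZero φ 𝔭 *
              (1 - cuspCoeff f p * ((p : ℂ))⁻¹ * heckeValueExtZero φ 𝔭) ^ 2)) : PadicAlgCl p) : ℂ_[p])) ∧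
      (s₂ : ℂ_[p]) * (algebraMap ℚ_[p] ℂ_[p]
          (((NumberField.classNumber K : ℚ_[p]))⁻¹ * Castella2018.padicLogOmega W p e P)) ^ 2 =
        a 0 * algebraMap ℚ_[p] ℂ_[p]
          ((-(W.LFunction p : ℚ_[p]) *
            (((1 : ℚ_[p]) - (W.LFunction p : ℚ_[p]) * (p : ℚ_[p])⁻¹) ^ 2))⁻¹) *
          (((ι.symm ((A₀ * B : ℝ) : ℂ)) : PadicAlgCl p) : ℂ_[p])

end Input

/-! ### §2 Algebra of the rescale (field identities) -/

section Algebra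

/-- **Lemma 1 (per-character identity, c2v MEMO-1 §2 / MEMO-18 §5): `X_k·Ω^{4n} = Y_k·c⁻¹·(D_t·D_𝔭)⁻¹`.**
`X_k` = Castella's display numerator at `Ω_K = 1` (`G·(1 − a_p p⁻¹φ(ϖ_𝔭))²·L(f/K,φ,1)/π^{2n+1}`, `G = Γ(n)Γ(n+1)`), `Y_k` = LZZ's
value (L1) with `φ(ϖ_𝔭) = Pw^n·D_𝔭` ((AV-p)) and `χ^{(ι)}(t) = D_t·T^{−n}`, `c = K₁C₁π(−a_p)/g`, and `Ω⁴ = gζζπ²·Pw/T`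
(the virtual period), `ξ` the χ-independent unit. Pure field identity (`n = m + 1`). [folklore] -/
theorem lzz_display_term_identity (ξ RS K1 C1 G gc zz piC ap pinv Dt T Pw Dp Om : ℂ) (m : ℕ)
    (hξ : ξ ≠ 0) (hK1 : K1 ≠ 0) (hC1 : C1 ≠ 0) (hpi : piC ≠ 0) (hap : ap ≠ 0) (hDt : Dt ≠ 0)
    (hT : T ≠ 0) (hDp : Dp ≠ 0) (hOm : Om ^ 4 = gc * zz * piC ^ 2 * Pw / T) :
    (G * (1 - ap * pinv * (Pw ^ (m + 1) * Dp)) ^ 2 * RS /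
        (piC ^ (2 * (m + 1) + 1) * (1 : ℂ) ^ (4 * (m + 1)))) * Om ^ (4 * (m + 1)) =
      (ξ * RS * K1 * (C1 * G * gc ^ m * zz ^ (m + 1) *
          (Dt * (T ^ (m + 1))⁻¹)) * (-ap * (Pw ^ (m + 1) * Dp) * (1 - ap * pinv * (Pw ^ (m + 1) * Dp)) ^ 2)) *
        (ξ * K1 * C1 * piC * (-ap) / gc)⁻¹ * (Dt * Dp)⁻¹ := by
  rw [show Om ^ (4 * (m + 1)) = (Om ^ 4) ^ (m + 1) from pow_mul Om 4 (m + 1), hOm, div_pow]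
  field_simp
  ring

/-- **Lemma 2 (the factor ledger, c2v MEMO-2 §3 / `X2.lzzLedger_constant_eq`): the unit.** With (L5), (L6) and
the true Thm. 3.8 constant `K₁ = π·ζ(2)/(4√δ·L1η²·LAd)`:
`[32g/(sC·c_M²·w²·√δ)]·(A₀B)·K₁·C₁·π/g·h² = 1` — every `h`, `Pet`, `ψ(N)`, `B`, `π` cancels. [folklore] -/
theorem lzz_unit_identity (gc sC cM w δs A₀ B Kc C₁ π' h Pet ψ LAd L1η : ℂ)
    (hgc : gc ≠ 0) (hsC : sC ≠ 0) (hcM : cM ≠ 0) (hw : w ≠ 0) (hδs : δs ≠ 0) (hA₀ : A₀ ≠ 0) (hB : B ≠ 0)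
    (hπ : π' ≠ 0) (hh : h ≠ 0) (hPet : Pet ≠ 0) (hψ : ψ ≠ 0)
    (hKc : Kc = π' * (π' ^ 2 / 6) / (4 * δs * L1η ^ 2 * LAd))
    (hcnf : L1η = 2 * π' * h / (w * δs))
    (hCol : LAd = 8 * π' ^ 3 * Pet * B / ψ)
    (hTam : C₁ * A₀ = sC * (24 * π' * cM ^ 2 * Pet / ψ)) :
    32 * gc / (sC * cM ^ 2 * w ^ 2 * δs) * (A₀ * B) * Kc * C₁ * π' / gc * h ^ 2 = 1 := by
  have hC₁ : C₁ = sC * (24 * π' * cM ^ 2 * Pet / ψ) / A₀ := by rw [← hTam]; field_simp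
  rw [hKc, hC₁, hCol, hcnf]
  field_simp
  ring

variable {p : ℕ} [Fact p.Prime]

/-- `ι⁻¹ : ℂ → ℚ̄_p ⊂ ℂ_p` sends an integer prime to `p` to a `p`-adic unit. [folklore] -/
theorem norm_map_intCast_eq_one (em : ℂ →+* ℂ_[p]) {k : ℤ} (hk : ¬ (p : ℤ) ∣ k) :
    ‖em (k : ℂ)‖ = 1 := by
  have hn : ¬ p ∣ k.natAbs := fun h ↦ hk (Int.natCast_dvd.mpr h)
  rcases Int.natAbs_eq k with h | h
  · rw [h, Int.cast_natCast]
    exact PNewDisplay.norm_map_natCast_eq_one em hn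
  · rw [h, Int.cast_neg, Int.cast_natCast, map_neg, norm_neg]
    exact PNewDisplay.norm_map_natCast_eq_one em hn

end Algebra

/-! ### §3 The input with the (L3′) radius clause on the OPEN unit disc (RULING L53) -/

section InputIoo

/-- **`LZZRoadInputIoo` — `LZZRoadInput` with the Amice-radius clause (L3′) CORRECTED to `0 < ρ < 1`** (RULING
L53, planner g21 2026-08-27T07:37Z, on bsd-eis-lit's implication audit 07:30Z): the body of `LZZRoadInput`
VERBATIM except that `∀ ρ : ℝ, ρ < 1 → ∃ C, ∀ m, ‖a m‖·ρ^m ≤ C` reads `∀ ρ ∈ Set.Ioo 0 1 → …` — the shape of a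
rigid function on the OPEN unit disc (LZZ §2.1 via [ST01]; Remark 3.2.7 (Duke p. 790): «`𝒟(1, ℚ_p; V^p)` is
isomorphic to the coordinate ring of a finite disjoint union of open unit disks») and LITERALLY the (L3′) clause
of the typist's fact `LiuZhangZhang2018.thm151_thm153_modularCurve_heegnerVector` (p509230: `∀ ρ, 0 < ρ → ρ < 1 →
…`, discharged here by `fun ρ hρ ↦ h ρ hρ.1 hρ.2`). As typed in `LZZRoadInput` the clause also quantified over
`ρ ≤ 0`, `|ρ| ≥ 1` (even `m`: `‖a_m‖·R^m ≤ C_R` for every `R`, i.e. entire-type decay of the even Amice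
coefficients), which the Amice transform of no non-polynomial-type Iwasawa function satisfies, so that input was
(almost certainly) unsatisfiable and every `LZZRoadInput → …` door vacuous; the gate's append-only rule forbids
editing a definition body in place («deprecate, don't mutate»), hence this SECOND predicate under a new name
(`LZZRoadInput` stays, superseded; `lzzRoadInputIoo_of_lzzRoadInput` records that it is the stronger statement).
Consumers re-target to this name: the rescale `X2/CellCBDPValueLZZRoadIoo.lean` (= p509400's proof, which only
uses the clause at `ρ = 1/2`) and the Theorems-side doors. Same data, same witnesses, same clauses (L1), (L2),
(L4)–(L6), (AV-p) — see `LZZRoadInput`'s docstring and the module docstring for the clause table and locators.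
A typed INPUT: hypothesis-shaped, nothing asserted; not claimed printed in this currency.
[cite: LiuZhangZhang2018, Thm. 3.8 and Thm. 3.10 and Prop. 4.12 (arXiv:1511.08172 pp. 18, 23) = Duke Thm. 3.2.10, Thm. 3.3.2, Prop. 4.3.4 (shape; nothing asserted)]
[cite: LiuZhangZhang2018, §2.1 and Remark 3.2.7 (Duke p. 790) (Amice power series on the open unit disc)]
[cite: Washington1997, §7.1 (power series on the open unit disc)] -/
@[conjecture]
def LZZRoadInputIoo : Prop :=
  ∀ {p : ℕ} [Fact p.Prime] (ι : PadicAlgCl p ≃+* ℂ) (W : WeierstrassCurve ℚ) [W.IsElliptic]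
    [W.IsGloballyMinimal] (K : Type) [Field K] [NumberField K] (𝔭 : HeightOneSpectrum (𝓞 K))
    (κ : ZpExtension K p) (γ : absoluteGaloisGroup K) {N : ℕ} [NeZero N]
    (Dt : ModularParametrizationData W N) (H : HeegnerDatum N (NumberField.discr K))
    (ιK : K →+* ℂ) (e : K →+* ℚ_[p]) (P : (W.baseChange K).toAffine.Point)
    (f : CuspForm (CongruenceSubgroup.Gamma0 N) 2),
    W.conductorNorm ℤ = N → p ∣ N → ¬ p ^ 2 ∣ N →
    IsImaginaryQuadratic K → ((Ideal.span {(p : ℤ)}).primesOver (𝓞 K)).ncard = 2 →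
    ((p : ℕ) : 𝓞 K) ∈ 𝔭.asIdeal →
    (∀ (w' : InfinitePlace K) (k : 𝓞 K), k ∈ 𝔭.asIdeal ↔ ‖ι.symm (w'.embedding (k : K))‖ < 1) →
    SatisfiesHeegnerHypothesis N K → κ.IsAnticyclotomic → κ.IsTopGenerator γ →
    IsNewformOf W f →
    WeierstrassCurve.Affine.Point.map ιK.toRatAlgHom P = heegnerPointComplex Dt H →
    (∀ k : 𝓞 K, k ∈ 𝔭.asIdeal ↔ ‖e (k : K)‖ < 1) →
    ∃ (a : ℕ → ℂ_[p]) (ζζ ξ : ℂ) (C₁ L1η A₀ Pet LAd B : ℝ) (aSM : ℤ) (sG sC s₂ : ℤ) (ϖ τ : ℚ_[p])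
      (σt σ𝔭 : absoluteGaloisGroup K),
      (∀ ρ : ℝ, ρ ∈ Set.Ioo (0 : ℝ) 1 → ∃ C : ℝ, ∀ m, ‖a m‖ * ρ ^ m ≤ C) ∧
      C₁ ≠ 0 ∧ ζζ ≠ 0 ∧ ‖((ι.symm ξ : PadicAlgCl p) : ℂ_[p])‖ = 1 ∧
      0 < L1η ∧ 0 < A₀ ∧ 0 < Pet ∧ LAd ≠ 0 ∧ 0 < B ∧ τ ≠ 0 ∧
      (ϖ = p ∨ ϖ = (p : ℚ_[p])⁻¹) ∧ (sG = 1 ∨ sG = -1) ∧ (sC = 1 ∨ sC = -1) ∧ (s₂ = 1 ∨ s₂ = -1) ∧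
      L1η = 2 * Real.pi * (NumberField.classNumber K : ℝ) /
        ((NumberField.Units.torsionOrder K : ℕ) * Real.sqrt |(NumberField.discr K : ℝ)|) ∧
      LAd = 8 * Real.pi ^ 3 * Pet * B / ((N : ℝ) * ∏ q ∈ N.primeFactors, (1 + ((q : ℝ))⁻¹)) ∧
      C₁ * A₀ = sC * (24 * Real.pi * ((Dt.c : ℝ)) ^ 2 * Pet /
        ((N : ℝ) * ∏ q ∈ N.primeFactors, (1 + ((q : ℝ))⁻¹))) ∧
      (∀ (φ : HeckeCharacter K) (n : ℕ) (r : FramedGaloisRep K (PadicAlgCl p) 1), 0 < n →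
        (∀ v : HeightOneSpectrum (𝓞 K), φ.IsUnramifiedAt v) →
        φ.HasInfinityType (fun _ ↦ (n : ℤ)) (fun _ ↦ -(n : ℤ)) →
        IsPAdicAvatarOf ι φ r → FactorsThroughZp κ r →
        ι.symm (heckeValueExtZero φ 𝔭) = (algebraMap ℚ_[p] (PadicAlgCl p) ϖ) ^ n *
            ((Matrix.GeneralLinearGroup.det (r σ𝔭) : (PadicAlgCl p)ˣ) : PadicAlgCl p) ∧
        HasSum (fun m ↦ a m * (avatarValueAt r γ - 1) ^ m)
          ((ι.symm (ξ *
            rankinSelbergValueHecke f φ 1 *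
            ((Real.pi : ℂ) * ((Real.pi : ℂ) ^ 2 / 6) /
              (4 * (Real.sqrt |(NumberField.discr K : ℝ)| : ℂ) * (L1η : ℂ) ^ 2 * (LAd : ℂ))) *
            ((C₁ : ℂ) * (Complex.Gamma (n : ℂ) * Complex.Gamma ((n : ℂ) + 1)) *
              ((sG : ℂ) * (2 : ℂ) ^ aSM) ^ (n - 1) * ζζ ^ n *
              ι (((Matrix.GeneralLinearGroup.det (r σt) : (PadicAlgCl p)ˣ) : PadicAlgCl p) *
                ((algebraMap ℚ_[p] (PadicAlgCl p) τ) ^ n)⁻¹)) *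
            (-(cuspCoeff f p) * heckeValueExtZero φ 𝔭 *
              (1 - cuspCoeff f p * ((p : ℂ))⁻¹ * heckeValueExtZero φ 𝔭) ^ 2)) : PadicAlgCl p) : ℂ_[p])) ∧
      (s₂ : ℂ_[p]) * (algebraMap ℚ_[p] ℂ_[p]
          (((NumberField.classNumber K : ℚ_[p]))⁻¹ * Castella2018.padicLogOmega W p e P)) ^ 2 =
        a 0 * algebraMap ℚ_[p] ℂ_[p]
          ((-(W.LFunction p : ℚ_[p]) *
            (((1 : ℚ_[p]) - (W.LFunction p : ℚ_[p]) * (p : ℚ_[p])⁻¹) ^ 2))⁻¹) *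
          (((ι.symm ((A₀ * B : ℝ) : ℂ)) : PadicAlgCl p) : ℂ_[p])

/-- The landed `LZZRoadInput` (radius clause over all `ρ < 1`) implies `LZZRoadInputIoo` (clause over
`0 < ρ < 1`): restrict the radius. (The converse fails; `LZZRoadInput` is the superseded, over-strong typing.)
[folklore] -/
theorem lzzRoadInputIoo_of_lzzRoadInput (h : LZZRoadInput) : LZZRoadInputIoo := by
  intro p _ ι W _ _ K _ _ 𝔭 κ γ N _ Dt H ιK e P f hN hpN hp2N hK hsplit h𝔭 hι hHN hκ hγ hfW hP he
  obtain ⟨a, ζζ, ξ, C₁, L1η, A₀, Pet, LAd, B, aSM, sG, sC, s₂, ϖ, τ, σt, σ𝔭, hrad, hrest⟩ :=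
    h ι W K 𝔭 κ γ Dt H ιK e P f hN hpN hp2N hK hsplit h𝔭 hι hHN hκ hγ hfW hP he
  exact ⟨a, ζζ, ξ, C₁, L1η, A₀, Pet, LAd, B, aSM, sG, sC, s₂, ϖ, τ, σt, σ𝔭,
    fun ρ hρ ↦ hrad ρ hρ.2, hrest⟩

end InputIoo

end Summit.BirchSwinnertonDyer.Rank1Residual.X2

end
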